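import Summits.QuantumFields.GaugeBoot.HaarTraceSmallBall
import Summits.QuantumFields.GaugeBoot.SU2WeakCouplingRateUniform
import HarnessLib

/-!
# Gauge-boot: the UNCONDITIONAL weak-coupling rate for EVERY compact gauge group, uniformly in the
# volume — `1 − ⟨ū_P⟩_{β,L} ≤ (2/N + (4N/(d−1))·(log(144N²) + log β))/β` (large-`N` supplement 18, part 2)

HONEST FRAMING (cell `pub-gaugeboot`, page 1 of every file): certified bounds on lattice
expectations at STATED coupling, gauge group, dimension and torus size; NOT a mass gap, NOT a
continuum limit, NOT a string tension, NOT large `N`; NOT Yang–Mills-summit-bearing (barriers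
`FixedCouplingUltralocality`, `PerturbativeInvisibility`).  An ASYMPTOTIC statement with the wrong power
of `log β` (the truth is `O(1/β)` by equipartition) and constants `∝ N²` per link (the ambient dimension
`2N²` of the covering argument, not `dim G`); at the couplings of the cell's tables the right-hand side
exceeds `1` and says nothing.  It certifies no number of CERTIFIED.md.

## Content

Part 1 (`HaarTraceSmallBall`) discharged the one-link small-ball hypothesis for every compact `G` and
every continuous `N`-dimensional `ρ`.  Here the gen-88 `SU(2)` chain (`SU2WeakCouplingRate`,
`SU2WeakCouplingRateUniform`) is rerun verbatim in that generality:

* ★ `WeakCoupling.sub_re_trace_plaquette_le` — the plaquette cost is controlled by the link costs,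
  `N − Re tr ρ(g₁g₂g₃⁻¹g₄⁻¹) ≤ 4·Σᵢ (N − Re tr ρ(gᵢ))` (Hilbert–Schmidt geometry of the unitarised
  representation: the tree's `UnitaryCayley.norm_one_sub_plaquetteWord_le`, Chatterjee 2016 Lemma 7.4);
  `wilsonAction_le_of_links` — link costs `≤ η` force `S ≤ 16·η·#P`;
* ★★ `WeakCoupling.le_measureReal_wilsonAction_le` — the torus small-ball bound
  `Haar^{⊗E}{S ≤ ε} ≥ (ε/(144·N²·#P))^{N²·|E|}` for `0 < ε ≤ 16·#P`;
* ★★★ `WeakCoupling.wilsonExpectation_wilsonAction_le` — for EVERY compact `G`, continuous `ρ` with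
  `N ≥ 1`, every `d`, every torus side `L` and every tree coupling `β ≥ 1`:
  `⟨S⟩_{β,L} ≤ (2·#P + 2·N²·|E|·(log(144N²) + log β))/β` (Laplace radius `ε = #P/β`: no `log #P`);
* ★★★ `WeakCoupling.one_sub_wilsonExpectation_meanPlaquette_le` — for `d ≥ 2`:
  **`1 − ⟨ū_P⟩_{β,L} ≤ (2/N + (4N/(d−1))·(log(144N²) + log β))/β`, uniformly in `L`** — the conditional
  rate of `WeakCouplingLimit.wilsonExpectation_wilsonAction_le_of_smallBall` made unconditional for all
  gauge groups at once (`SU(N)`, `U(N)`, `SO(N)`, `Sp(N)`, exceptional, finite, products).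

[folklore] (Laplace principle + Gibbs–Jensen with a covering small-ball estimate.)
-/

noncomputable section

open MeasureTheory Filter Topology
open scoped Matrix.Norms.Frobenius
open Literature.MathematicalPhysics.QuantumFieldTheory
open Literature.RepresentationTheory.CompactGroups
open Literature.RepresentationTheory.CompactGroups.CompactGroup (unitarize unitarize_mem_unitaryGroup)

namespace Summit.QuantumFields.GaugeBoot

namespace WeakCoupling

/-! ## The plaquette cost is controlled by the four link costs -/

section Cost

variable {N : ℕ} {G : Type*} [Group G] [TopologicalSpace G] [IsTopologicalGroup G] [CompactSpace G]
  (ρ : G →* Matrix (Fin N) (Fin N) ℂ)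

/-- Hilbert–Schmidt form: `‖1 − U₁U₂U₃⁻¹U₄⁻¹‖² ≤ 4·Σᵢ ‖1 − Uᵢ‖²` in `U(N)` (square of the tree's
`UnitaryCayley.norm_one_sub_plaquetteWord_le`). [folklore] -/
theorem norm_one_sub_plaquetteWord_sq_le (U₁ U₂ U₃ U₄ : Matrix.unitaryGroup (Fin N) ℂ) :
    ‖(1 : Matrix (Fin N) (Fin N) ℂ) - ((U₁ * U₂ * U₃⁻¹ * U₄⁻¹ : Matrix.unitaryGroup (Fin N) ℂ) : Matrix (Fin N) (Fin N) ℂ)‖ ^ 2 ≤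
      4 * (‖(1 : Matrix (Fin N) (Fin N) ℂ) - (U₁ : Matrix (Fin N) (Fin N) ℂ)‖ ^ 2
        + ‖(1 : Matrix (Fin N) (Fin N) ℂ) - (U₂ : Matrix (Fin N) (Fin N) ℂ)‖ ^ 2
        + ‖(1 : Matrix (Fin N) (Fin N) ℂ) - (U₃ : Matrix (Fin N) (Fin N) ℂ)‖ ^ 2
        + ‖(1 : Matrix (Fin N) (Fin N) ℂ) - (U₄ : Matrix (Fin N) (Fin N) ℂ)‖ ^ 2) := by
  have h := UnitaryCayley.norm_one_sub_plaquetteWord_le U₁ U₂ U₃ U₄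
  have h0 := norm_nonneg ((1 : Matrix (Fin N) (Fin N) ℂ) - ((U₁ * U₂ * U₃⁻¹ * U₄⁻¹ : Matrix.unitaryGroup (Fin N) ℂ) :
    Matrix (Fin N) (Fin N) ℂ))
  set X := ‖(1 : Matrix (Fin N) (Fin N) ℂ) - ((U₁ * U₂ * U₃⁻¹ * U₄⁻¹ : Matrix.unitaryGroup (Fin N) ℂ) :
    Matrix (Fin N) (Fin N) ℂ)‖
  set a₁ := ‖(1 : Matrix (Fin N) (Fin N) ℂ) - (U₁ : Matrix (Fin N) (Fin N) ℂ)‖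
  set a₂ := ‖(1 : Matrix (Fin N) (Fin N) ℂ) - (U₂ : Matrix (Fin N) (Fin N) ℂ)‖
  set a₃ := ‖(1 : Matrix (Fin N) (Fin N) ℂ) - (U₃ : Matrix (Fin N) (Fin N) ℂ)‖
  set a₄ := ‖(1 : Matrix (Fin N) (Fin N) ℂ) - (U₄ : Matrix (Fin N) (Fin N) ℂ)‖
  have hs : X * X ≤ (a₁ + a₂ + a₃ + a₄) * (a₁ + a₂ + a₃ + a₄) := mul_self_le_mul_self h0 h
  nlinarith [hs, sq_nonneg (a₁ - a₂), sq_nonneg (a₁ - a₃), sq_nonneg (a₁ - a₄), sq_nonneg (a₂ - a₃),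
    sq_nonneg (a₂ - a₄), sq_nonneg (a₃ - a₄)]

/-- ★ **Link costs control the plaquette cost, every compact `G`**: for a continuous `N`-dimensional
representation `ρ` and `g₁, …, g₄ ∈ G`,
`N − Re tr ρ(g₁g₂g₃⁻¹g₄⁻¹) ≤ 4·Σᵢ (N − Re tr ρ(gᵢ))` (Chatterjee 2016 Lemma 7.4 for the unitarised
representation; `N − Re tr ρ = ‖1 − σ‖²/2`). [folklore] -/
theorem sub_re_trace_plaquette_le (hρ : Continuous ρ) (g₁ g₂ g₃ g₄ : G) :
    (N : ℝ) - ((ρ (g₁ * g₂ * g₃⁻¹ * g₄⁻¹)).trace).re ≤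
      4 * (((N : ℝ) - ((ρ g₁).trace).re) + ((N : ℝ) - ((ρ g₂).trace).re)
        + ((N : ℝ) - ((ρ g₃).trace).re) + ((N : ℝ) - ((ρ g₄).trace).re)) := by
  -- the unitarised representation as a homomorphism INTO `U(N)`
  set σ : G →* Matrix.unitaryGroup (Fin N) ℂ :=
    (unitarize ρ hρ).codRestrict (Matrix.unitaryGroup (Fin N) ℂ) (unitarize_mem_unitaryGroup ρ hρ) with hσ
  have hcoe : ∀ g, ((σ g : Matrix.unitaryGroup (Fin N) ℂ) : Matrix (Fin N) (Fin N) ℂ) = unitarize ρ hρ g := fun _ => rfl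
  have hw : unitarize ρ hρ (g₁ * g₂ * g₃⁻¹ * g₄⁻¹) =
      ((σ g₁ * σ g₂ * (σ g₃)⁻¹ * (σ g₄)⁻¹ : Matrix.unitaryGroup (Fin N) ℂ) : Matrix (Fin N) (Fin N) ℂ) := by
    rw [← map_inv, ← map_inv, ← map_mul, ← map_mul, ← map_mul]
    exact (hcoe _).symm
  rw [HaarCovering.sub_re_trace_eq_norm_sq ρ hρ, HaarCovering.sub_re_trace_eq_norm_sq ρ hρ g₁,
    HaarCovering.sub_re_trace_eq_norm_sq ρ hρ g₂, HaarCovering.sub_re_trace_eq_norm_sq ρ hρ g₃,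
    HaarCovering.sub_re_trace_eq_norm_sq ρ hρ g₄, hw, ← hcoe g₁, ← hcoe g₂, ← hcoe g₃, ← hcoe g₄]
  have h := norm_one_sub_plaquetteWord_sq_le (σ g₁) (σ g₂) (σ g₃) (σ g₄)
  linarith

end Cost

/-! ## The Wilson action under small link costs, and the torus small-ball bound -/

section Torus

variable {d L N : ℕ} {G : Type*} [Group G] [TopologicalSpace G] [IsTopologicalGroup G]
  [CompactSpace G] [MeasurableSpace G] [BorelSpace G] (ρ : G →* Matrix (Fin N) (Fin N) ℂ)

omit [MeasurableSpace G] [BorelSpace G] in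
/-- **If every link has cost `N − Re tr ρ(U_e) ≤ η` then `S(U) ≤ 16·η·#P`** (every compact `G`). [folklore] -/
theorem wilsonAction_le_of_links [NeZero L] (hρ : Continuous ρ) (U : GaugeConfig d L G) {η : ℝ}
    (hU : ∀ e : Edge d L, (N : ℝ) - ((ρ (U e)).trace).re ≤ η) :
    wilsonAction ρ U ≤ 16 * η * (Fintype.card (Plaquette d L) : ℝ) := by
  unfold wilsonAction
  have hterm : ∀ p : Plaquette d L,
      (N : ℝ) - ((ρ (plaquetteHolonomy U p.1 p.2.1.1 p.2.1.2)).trace).re ≤ 16 * η := by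
    intro p
    rw [plaquetteHolonomy]
    have h := sub_re_trace_plaquette_le ρ hρ (U (p.1, p.2.1.1)) (U (p.1.shift p.2.1.1, p.2.1.2))
      (U (p.1.shift p.2.1.2, p.2.1.1)) (U (p.1, p.2.1.2))
    have e1 := hU (p.1, p.2.1.1)
    have e2 := hU (p.1.shift p.2.1.1, p.2.1.2)
    have e3 := hU (p.1.shift p.2.1.2, p.2.1.1)
    have e4 := hU (p.1, p.2.1.2)
    linarith
  calc ∑ p : Plaquette d L, ((N : ℝ) - ((ρ (plaquetteHolonomy U p.1 p.2.1.1 p.2.1.2)).trace).re)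
      ≤ ∑ _p : Plaquette d L, 16 * η := Finset.sum_le_sum fun p _ => hterm p
    _ = 16 * η * (Fintype.card (Plaquette d L) : ℝ) := by rw [Finset.sum_const, Finset.card_univ, nsmul_eq_mul]; ring

/-- ★★ **Torus small-ball bound, every compact `G`**: for a continuous `N`-dimensional `ρ` (`N ≥ 1`) and
`0 < ε ≤ 16·#P`: `(ε/(144·N²·#P))^{N²·|E|} ≤ Haar^{⊗E}{S ≤ ε}` (product of the one-link bound of part 1 at
`η = ε/(16·#P)`). [folklore] -/
theorem le_measureReal_wilsonAction_le [NeZero L] [Nonempty (Plaquette d L)] (hρ : Continuous ρ) (hN : N ≠ 0) {ε : ℝ}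
    (hε0 : 0 < ε) (hε : ε ≤ 16 * Fintype.card (Plaquette d L)) :
    (ε / (144 * (N : ℝ) ^ 2 * Fintype.card (Plaquette d L))) ^ (N ^ 2 * Fintype.card (Edge d L)) ≤
      (Measure.pi fun _ : Edge d L => haarProbability G).real {U : GaugeConfig d L G | wilsonAction ρ U ≤ ε} := by
  set P : ℝ := (Fintype.card (Plaquette d L) : ℝ) with hPdef
  have hP : (1 : ℝ) ≤ P := by rw [hPdef]; exact_mod_cast Fintype.card_pos
  set η : ℝ := ε / (16 * P) with hη
  have hη0 : 0 < η := by positivity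
  have hη1 : η ≤ 1 := by rw [hη, div_le_one (by positivity)]; linarith
  set T : Set G := {g : G | (N : ℝ) - ((ρ g).trace).re ≤ η} with hT
  set A : Set (GaugeConfig d L G) := Set.pi Set.univ fun _ : Edge d L => T with hA
  set π₀ := Measure.pi fun _ : Edge d L => haarProbability G with hπ₀
  have hsub : A ⊆ {U : GaugeConfig d L G | wilsonAction ρ U ≤ ε} := by
    intro U hUA
    have hU : ∀ e : Edge d L, (N : ℝ) - ((ρ (U e)).trace).re ≤ η := fun e => hUA e (Set.mem_univ e)
    have h := wilsonAction_le_of_links ρ hρ U hU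
    have : 16 * η * P = ε := by rw [hη]; field_simp
    show wilsonAction ρ U ≤ ε
    rw [← this]; exact h
  have hπA : ENNReal.ofReal (((η / (9 * (N : ℝ) ^ 2)) ^ (N ^ 2)) ^ Fintype.card (Edge d L)) ≤ π₀ A := by
    rw [hπ₀, hA, Measure.pi_pi, Finset.prod_const, Finset.card_univ, ENNReal.ofReal_pow (by positivity)]
    exact pow_le_pow_left' (HaarCovering.le_haarProbability_setOf_sub_re_trace_le ρ hρ hN hη0 hη1) _
  have hfin : π₀ {U : GaugeConfig d L G | wilsonAction ρ U ≤ ε} ≠ ⊤ := measure_ne_top _ _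
  have hreal : ((η / (9 * (N : ℝ) ^ 2)) ^ (N ^ 2)) ^ Fintype.card (Edge d L) ≤
      π₀.real {U : GaugeConfig d L G | wilsonAction ρ U ≤ ε} := by
    rw [measureReal_def, ← ENNReal.ofReal_le_iff_le_toReal hfin]
    exact hπA.trans (measure_mono hsub)
  have harith : (ε / (144 * (N : ℝ) ^ 2 * P)) ^ (N ^ 2 * Fintype.card (Edge d L)) =
      ((η / (9 * (N : ℝ) ^ 2)) ^ (N ^ 2)) ^ Fintype.card (Edge d L) := by
    rw [pow_mul]
    congr 1
    rw [hη]
    field_simp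
    ring
  rw [harith]
  exact hreal

/-- ★★★ **Weak-coupling rate, every compact gauge group, uniformly in the volume (mean action).**  For a
continuous `N`-dimensional `ρ` (`N ≥ 1`), every `d`, every torus with plaquettes and every tree coupling
`β ≥ 1`: `⟨S⟩_{β,L} ≤ (2·#P + 2·N²·|E|·(log(144N²) + log β))/β`. [folklore] -/
theorem wilsonExpectation_wilsonAction_le [NeZero L] [Nonempty (Plaquette d L)] (hρ : Continuous ρ) (hN : N ≠ 0)
    {β : ℝ} (hβ : 1 ≤ β) :
    wilsonExpectation ρ β (wilsonAction (d := d) (L := L) (G := G) ρ) ≤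
      (2 * Fintype.card (Plaquette d L)
        + 2 * ((N : ℝ) ^ 2 * Fintype.card (Edge d L)) * (Real.log (144 * (N : ℝ) ^ 2) + Real.log β)) / β := by
  set P : ℝ := (Fintype.card (Plaquette d L) : ℝ) with hPdef
  set E : ℕ := Fintype.card (Edge d L) with hEdef
  have hP : (1 : ℝ) ≤ P := by rw [hPdef]; exact_mod_cast Fintype.card_pos
  have hN' : (0 : ℝ) < N := by exact_mod_cast Nat.pos_of_ne_zero hN
  have hβ0 : 0 < β := by linarith
  have hε0 : 0 < P / β := by positivity
  have hε : P / β ≤ 16 * Fintype.card (Plaquette d L) := by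
    rw [← hPdef, div_le_iff₀ hβ0]; nlinarith
  have h := wilsonExpectation_wilsonAction_le_laplace (d := d) (L := L) ρ hρ (re_trace_le_of_continuous ρ hρ) hβ0 hε0
  set p : ℝ := (Measure.pi fun _ : Edge d L => haarProbability G).real
    {U : GaugeConfig d L G | wilsonAction ρ U ≤ P / β} with hp
  have hsb : (P / β / (144 * (N : ℝ) ^ 2 * P)) ^ (N ^ 2 * E) ≤ p := le_measureReal_wilsonAction_le ρ hρ hN hε0 hε
  have hbase : P / β / (144 * (N : ℝ) ^ 2 * P) = (144 * (N : ℝ) ^ 2 * β)⁻¹ := by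
    field_simp
  rw [hbase] at hsb
  have hc : (0 : ℝ) < ((144 * (N : ℝ) ^ 2 * β)⁻¹) ^ (N ^ 2 * E) := by positivity
  -- `-log p ≤ N²E (log(144N²) + log β)`
  have hlog : -Real.log p ≤ ((N : ℝ) ^ 2 * E) * (Real.log (144 * (N : ℝ) ^ 2) + Real.log β) := by
    have h1 := Real.log_le_log hc hsb
    rw [Real.log_pow, Real.log_inv, Real.log_mul (by positivity) hβ0.ne'] at h1
    push_cast at h1
    linarith
  have h2 : 2 * (P / β) - 2 / β * Real.log p ≤
      (2 * P + 2 * ((N : ℝ) ^ 2 * E) * (Real.log (144 * (N : ℝ) ^ 2) + Real.log β)) / β := by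
    rw [show 2 * (P / β) - 2 / β * Real.log p = (2 * P + 2 * (-Real.log p)) / β by ring]
    exact div_le_div_of_nonneg_right (by nlinarith) hβ0.le
  exact h.trans h2

/-- ★★★ **Weak-coupling rate for the mean plaquette, every compact gauge group, uniformly in `L`.**  For a
continuous `N`-dimensional `ρ` (`N ≥ 1`), `d ≥ 2`, EVERY torus side `L` and tree coupling `β ≥ 1`:
`1 − ⟨ū_P⟩_{β,L} ≤ (2/N + (4N/(d−1))·(log(144N²) + log β))/β`. [folklore] -/
theorem one_sub_wilsonExpectation_meanPlaquette_le [NeZero L] (hρ : Continuous ρ) (hN : N ≠ 0) (hd : 2 ≤ d)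
    {β : ℝ} (hβ : 1 ≤ β) :
    1 - wilsonExpectation ρ β (meanPlaquette (d := d) (L := L) (G := G) ρ) ≤
      (2 / N + 4 * N / ((d : ℝ) - 1) * (Real.log (144 * (N : ℝ) ^ 2) + Real.log β)) / β := by
  haveI := nonempty_plaquette_of_two_le (L := L) hd
  rw [wilsonExpectation_meanPlaquette_eq ρ hρ hN, sub_sub_cancel]
  have hP : (0 : ℝ) < Fintype.card (Plaquette d L) := by exact_mod_cast Fintype.card_pos
  have hN' : (0 : ℝ) < N := by exact_mod_cast Nat.pos_of_ne_zero hN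
  have hβ0 : 0 < β := by linarith
  have h := wilsonExpectation_wilsonAction_le (d := d) (L := L) ρ hρ hN hβ
  rw [SU2Rate.card_edge_eq_div d L hd] at h
  have hd' : (0 : ℝ) < (d : ℝ) - 1 := by
    have : (2 : ℝ) ≤ d := by exact_mod_cast hd
    linarith
  rw [div_le_iff₀ (by positivity)]
  calc wilsonExpectation ρ β (wilsonAction (d := d) (L := L) (G := G) ρ)
      ≤ (2 * Fintype.card (Plaquette d L)
          + 2 * ((N : ℝ) ^ 2 * (2 / ((d : ℝ) - 1) * Fintype.card (Plaquette d L)))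
            * (Real.log (144 * (N : ℝ) ^ 2) + Real.log β)) / β := h
    _ = (2 / N + 4 * N / ((d : ℝ) - 1) * (Real.log (144 * (N : ℝ) ^ 2) + Real.log β)) / β
          * (N * Fintype.card (Plaquette d L)) := by
          field_simp
          ring

end Torus

end WeakCoupling

end Summit.QuantumFields.GaugeBoot

end
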